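import Literature.AnabelianGeometry.SemiGraphs.PSCSmoothCurveGenuineSturdyLevels
import Literature.AnabelianGeometry.SemiGraphs.PSCSmoothCurveGenuineRank
import Literature.AnabelianGeometry.SemiGraphs.PSCSmoothProperGenuineSturdy
import Literature.AnabelianGeometry.SemiGraphs.CharacteristicOpenCoreProP
import Literature.AnabelianGeometry.SemiGraphs.ProSigmaCompletionHomCount
import Literature.AnabelianGeometry.SemiGraphs.ProSigmaCompletionTFG
import Literature.AnabelianGeometry.AbsoluteAnabelian.LocalReciprocityCofinal
import HarnessLib

/-!
# [CombGC] Def. 1.1 (ii) "sturdy" and Rmk. 1.1.5 (`SturdyCoverHolds`) at genuine smooth-CURVE data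

Mochizuki, *A combinatorial version of the Grothendieck conjecture* [CombGC], Tohoku Math. J. **59**
(2007), Def. 1.1 (ii) p. 7 ("If the abelianization of every unramified verticial subgroup of `Π^unr_G` is
free of rank `≥ 2` [read `> 2`, Hoshi–Mochizuki CbTpII Rmk. 1.1.2] over `Ẑ^Σ`, then we shall say that `G`
is sturdy"), Rmk. 1.1.5 p. 8 ("sturdy ⟺ every irreducible component … of genus `≥ 2`"; "there always
exists a characteristic open subgroup `H ⊆ Π_G` … every `Π_G`-covering `G′ → G` with `Π_{G′} ⊆ H` is
sturdy"). [cite: MochizukiCombGC2007, Rmk 1.1.5 p.8] [cite: MochizukiCombGC2007, Def 1.1(ii) p.7]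

PROOF-ONLY file (abc-iut cell, layer L3, [CombGC] non-vacuity programme; seat abc-iut-w5-d195 gen 7,
brick «SC-GENUINE-COVERING-CLOSED», part E2; sequel of `PSCSmoothCurveGenuineSturdyLevels.lean`,
`PSCSmoothCurveGenuineRank.lean`, and the smooth-PROPER twin `PSCSmoothProperGenuineSturdy.lean`).  At a
GENUINE smooth-curve datum (profinite `Π`, one vertex `Π_v = Π`, no nodes, `ι : Γ_{g,r} → Π` a pro-`Σ`
completion of a hyperbolic punctured surface group, cusp groups conjugates of `closure ι⟨c_j⟩`,
`genus(v) = g`):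

* `exists_isProSigmaCompletion_quotient_unrAbKer` — for every `W = Π` and `K = W ∩ Ker(Π ↠ M^unr)`:
  `W ⧸ K` is the pro-`Σ` completion of `ℤ^{2g}` (`PSCSmoothCurveGenuineRank`);
* `isSturdyAt_top_of_smoothCurveGenuine` (`g ≥ 2 ⇒` Def. 1.1 (ii)-sturdy at the trivial level) and
  `two_le_of_isSturdyAt_top_smoothCurveGenuine` (the converse, by the RANK INVARIANCE of pro-`Σ`
  completions of free abelian groups, `IsProSigmaCompletion.rank_eq_of_continuousMulEquiv`); hence
  `sturdyAtTopIffSturdy_of_smoothCurveGenuine` — **Rmk. 1.1.5, first sentence, HOLDS** (also at genus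
  `0, 1`, where both sides fail);
* `isSturdyAt_of_smoothCurveGenuine_of_le` — every open `U` below the genus-`≥ 2` Galois level `V` of
  `exists_open_normal_forall_two_le_genus_restrict` is Def. 1.1 (ii)-sturdy (`G_U` is a genuine smooth
  curve of genus `≥ 2`, `restrict_smoothCurveGenuine` + abc-iut-w5-d226's bridge
  `isSturdyAt_restrict_top_iff`);
* `sturdyCoverHolds_of_smoothCurveGenuine_singleton` — **Rmk. 1.1.5 (`SturdyCoverHolds Ω`) HOLDS at every
  origin of genuine smooth-curve data with `Σ = {ℓ}`**: the characteristic open `H ⊆ V` is abc-iut-f-164's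
  `exists_characteristic_isOpen_le_of_proP` (Serre: abstract automorphisms of a topologically finitely
  generated pro-`ℓ` group are continuous, so the characteristic open cores ARE `Subgroup.Characteristic`
  in Mathlib's abstract sense).  HONEST SCOPE: for general `Σ` the typed (abstract) "characteristic"
  would need Nikolov–Segal; the Thm. 1.6 assemblies are stated at `Σ = {ℓ}`.

Consistency / non-vacuity evidence at genuine one-component data WITH cusps (the tripod included: there
`H ≠ Π`); not the printed theorems for all pointed stable curves; 0 definitions; nothing here takes a side
on [IUTchIII] Cor. 3.12.
-/

noncomputable section

namespace Literature.AnabelianGeometry.SemiGraphs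

namespace PSCDatum

open scoped Pointwise
open Literature.GroupTheory.CombinatorialGroupTheory
open Literature.GroupTheory.CombinatorialGroupTheory.PuncturedSurfaceGroup (cuspInertia IsHyperbolicType
  nonempty_mulEquiv_quotient_commutator_sup_cusps)
open Literature.AnabelianGeometry.AbsoluteAnabelian (IsTopologicallyFinitelyGenerated)
open SemiGraphOfAnabelioids (IsProSigmaCompletion)

universe u

variable {P : Type u} [Group P] [TopologicalSpace P] [IsTopologicalGroup P]

/-! ### `Π ⧸ Ker(Π ↠ M^unr)` is the pro-`Σ` completion of `ℤ^{2g}`, on any copy `W = Π` -/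

/-- For a genuine smooth-curve datum and any subgroup `W = Π` with `K = W ∩ Ker(Π ↠ M^unr_G)`: `W ⧸ K` is
the pro-`Σ` completion of `ℤ^{2g}` (the kernel is the closure of `ι([Γ,Γ]·⟨⟨c_j⟩⟩)` and
`Γ_{g,r} ⧸ ([Γ,Γ]·⟨⟨c_j⟩⟩) ≅ ℤ^{2g}`, `PSCSmoothCurveGenuineRank.lean`).  The form in which both Def. 1.1
(ii)'s "sturdy" (`W = unrVertAt ⊤ A`) and Rmk. 1.1.5's rank statement (`W = unrVertAbOf v`) consume it.
[cite: MochizukiCombGC2007, Rmk 1.1.5 p.8] -/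
theorem exists_isProSigmaCompletion_quotient_unrAbKer [T2Space P] (G : PSCDatum P) [IsEmpty G.graph.N]
    {g r : ℕ} (ι : PuncturedSurfaceGroup g r →* P) (hι : IsProSigmaCompletion G.Sigma ι)
    (e : G.graph.C ≃ Fin r)
    (hC : ∀ c, ∃ δ : ConjAct P,
      G.cuspGp c = δ • ((cuspInertia (g := g) (e c)).map ι).topologicalClosure)
    (W : Subgroup P) (hW : W = ⊤) (K : Subgroup W) [K.Normal]
    (hK : (K : Set W) = Subtype.val ⁻¹' (G.unrAbKer : Set P)) :
    ∃ ι' : Multiplicative (Fin (2 * g) → ℤ) →* W ⧸ K, IsProSigmaCompletion G.Sigma ι' := by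
  classical
  have hmem : ∀ x, ι x ∈ W := fun x => by rw [hW]; exact Subgroup.mem_top _
  let ιW : PuncturedSurfaceGroup g r →* W := ι.codRestrict W hmem
  let eW : W ≃* P := (MulEquiv.subgroupCongr hW).trans Subgroup.topEquiv
  have he_apply : ∀ x : W, eW x = (x : P) := fun _ => rfl
  have he : Continuous eW := by
    have : (eW : W → P) = Subtype.val := funext he_apply
    rw [this]; exact continuous_subtype_val
  have hes : Continuous eW.symm := by
    have : (eW.symm : P → W) = fun p => ⟨p, hW ▸ Subgroup.mem_top p⟩ := by
      funext p
      apply Subtype.ext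
      change ((eW (eW.symm p)) : P) = p
      rw [MulEquiv.apply_symm_apply]
    rw [this]
    exact continuous_id.subtype_mk _
  have hιW : IsProSigmaCompletion G.Sigma ιW :=
    IsProSigmaCompletion.of_target_mulEquiv hι eW he hes fun _ => rfl
  set N' : Subgroup (PuncturedSurfaceGroup g r) := commutator (PuncturedSurfaceGroup g r) ⊔
    Subgroup.normalClosure (⋃ j, (cuspInertia (g := g) (r := r) j : Set (PuncturedSurfaceGroup g r)))
    with hN'
  have hK' : (K : Set W) = closure (ιW '' ((N' : Subgroup _) : Set _)) := by
    rw [hK, Topology.IsEmbedding.subtypeVal.closure_eq_preimage_closure_image, Set.image_image]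
    change Subtype.val ⁻¹' (G.unrAbKer : Set P) = Subtype.val ⁻¹' closure ((fun x => ι x) '' _)
    rw [G.unrAbKer_eq_closure_map_of_smoothCurve' ι hι e hC, Subgroup.topologicalClosure_coe,
      Subgroup.coe_map]
  have hφ := IsProSigmaCompletion.quotientMap_of_coe_eq_closure hιW N' K hK'
  obtain ⟨eN⟩ := nonempty_mulEquiv_quotient_commutator_sup_cusps g r
  have hcard : Fintype.card (Fin g × Bool) = 2 * g := by
    rw [Fintype.card_prod, Fintype.card_fin, Fintype.card_bool, mul_comm]
  let eIdx : Fin (2 * g) ≃ (Fin g × Bool) := (Fintype.equivFinOfCardEq hcard).symm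
  let eFun : Multiplicative (Fin (2 * g) → ℤ) ≃* Multiplicative ((Fin g × Bool) → ℤ) :=
    AddEquiv.toMultiplicative (LinearEquiv.funCongrLeft ℤ ℤ eIdx).symm.toAddEquiv
  let eab : Multiplicative (Fin (2 * g) → ℤ) ≃* PuncturedSurfaceGroup g r ⧸ N' :=
    (eFun.trans (MulEquiv.funMultiplicative _ _)).trans eN
  have hle : N' ≤ K.comap ιW :=
    IsProSigmaCompletion.le_comap_of_image_subset
      (IsProSigmaCompletion.image_subset_of_coe_eq_closure hK')
  exact ⟨(QuotientGroup.map _ K ιW hle).comp eab.toMonoidHom,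
    IsProSigmaCompletion.of_comp_mulEquiv eab (fun _ => rfl) hφ⟩

/-! ### Def. 1.1 (ii) "sturdy" at the trivial level ⟺ genus `≥ 2` -/

section Top

variable [T2Space P] (G : PSCDatum P) [IsEmpty G.graph.N] {g r : ℕ}

/-- **`g ≥ 2 ⇒` Def. 1.1 (ii)-sturdy at the trivial level** (genuine smooth curve): the only verticial
subgroup of `Π_{G_Π} = Π` is `Π`, whose unramified abelianisation `Π ⧸ Ker(Π ↠ M^unr)` is the pro-`Σ`
completion of `ℤ^{2g}`, `2g > 2`. [cite: MochizukiCombGC2007, Def 1.1(ii) p.7] -/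
theorem isSturdyAt_top_of_smoothCurveGenuine (hV : ∀ v, G.vertGp v = ⊤) (hg : 2 ≤ g)
    (ι : PuncturedSurfaceGroup g r →* P) (hι : IsProSigmaCompletion G.Sigma ι) (e : G.graph.C ≃ Fin r)
    (hC : ∀ c, ∃ δ : ConjAct P,
      G.cuspGp c = δ • ((cuspInertia (g := g) (e c)).map ι).topologicalClosure) :
    G.IsSturdyAt ⊤ := by
  intro A hA _
  have hAtop : A = ⊤ := G.eq_top_of_isVerticialIn_top hV hA
  have hW : G.unrVertAt ⊤ A = ⊤ := by rw [unrVertAt_top, hAtop, top_sup_eq]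
  have hK : (((G.unrVertAbKerAt ⊤ A).subgroupOf (G.unrVertAt ⊤ A) : Subgroup (G.unrVertAt ⊤ A)) :
      Set (G.unrVertAt ⊤ A)) = Subtype.val ⁻¹' (G.unrAbKer : Set P) := by
    rw [Subgroup.coe_subgroupOf, G.unrVertAbKerAt_top_eq_unrAbKer hAtop]
    rfl
  obtain ⟨ι', hι'⟩ := G.exists_isProSigmaCompletion_quotient_unrAbKer ι hι e hC _ hW _ hK
  exact ⟨2 * g, by omega, ι', hι'⟩

variable [CompactSpace P] [TotallyDisconnectedSpace P]

/-- **Def. 1.1 (ii)-sturdy at the trivial level `⇒ g ≥ 2`** (genuine smooth curve): a pro-`Σ` completion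
of `ℤ^{r'}` with `r' > 2` and the pro-`Σ` completion of `ℤ^{2g}` of the SAME profinite group
`Π ⧸ Ker(Π ↠ M^unr)` have `r' = 2g` (rank invariance, counting continuous characters to `ℤ/ℓ`,
`ℓ ∈ Σ`). [cite: MochizukiCombGC2007, Rmk 1.1.5 p.8] -/
theorem two_le_of_isSturdyAt_top_smoothCurveGenuine (hV : ∀ v, G.vertGp v = ⊤) (v₀ : G.graph.V)
    (ι : PuncturedSurfaceGroup g r →* P) (hι : IsProSigmaCompletion G.Sigma ι) (e : G.graph.C ≃ Fin r)
    (hC : ∀ c, ∃ δ : ConjAct P,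
      G.cuspGp c = δ • ((cuspInertia (g := g) (e c)).map ι).topologicalClosure)
    (hst : G.IsSturdyAt ⊤) : 2 ≤ g := by
  have hvert : G.IsVerticialIn ⊤ ⊤ :=
    ⟨(1 : ConjAct P) • G.vertGp v₀, ⟨v₀, 1, rfl⟩, by rw [one_smul, hV, top_inf_eq]⟩
  set W : Subgroup P := G.unrVertAt ⊤ ⊤ with hWdef
  have hW : W = ⊤ := by rw [hWdef, unrVertAt_top, top_sup_eq]
  haveI hn0 : (G.unrVertAbKerAt ⊤ ⊤).Normal := by
    rw [G.unrVertAbKerAt_top_eq_unrAbKer rfl, unrAbKer]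
    exact Subgroup.is_normal_topologicalClosure _
  set K : Subgroup W := (G.unrVertAbKerAt ⊤ ⊤).subgroupOf W with hKdef
  have hK : (K : Set W) = Subtype.val ⁻¹' (G.unrAbKer : Set P) := by
    rw [hKdef, Subgroup.coe_subgroupOf, G.unrVertAbKerAt_top_eq_unrAbKer rfl]
    rfl
  obtain ⟨r', hr', ι', hι'⟩ := hst ⊤ hvert
  obtain ⟨ι₂, hι₂⟩ := G.exists_isProSigmaCompletion_quotient_unrAbKer ι hι e hC W hW K hK
  -- `W ⧸ K` is profinite
  have hWc : IsClosed (W : Set P) := by rw [hW, Subgroup.coe_top]; exact isClosed_univ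
  haveI : CompactSpace W := isCompact_iff_compactSpace.mp hWc.isCompact
  have hKc : IsClosed (K : Set W) := by
    rw [hK]; exact (G.isClosed_unrAbKer).preimage continuous_subtype_val
  haveI : TotallyDisconnectedSpace (W ⧸ K) :=
    AbsoluteAnabelian.QuotientGroup.totallyDisconnectedSpace_of_isClosed K hKc
  obtain ⟨ℓ, hℓS⟩ := G.sigma_nonempty
  have hrank := IsProSigmaCompletion.rank_eq_of_continuousMulEquiv hι' hι₂ (G.sigma_prime ℓ hℓS) hℓS
    (ContinuousMulEquiv.refl _)
  omega

/-- **[CombGC] Rmk. 1.1.5, first sentence, HOLDS at a genuine smooth-curve datum**: Def. 1.1 (ii)'s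
rank form of "sturdy" at the trivial covering ⟺ the genus form `IsSturdy` (every vertex of genus
`≥ 2`). [cite: MochizukiCombGC2007, Rmk 1.1.5 p.8] -/
theorem sturdyAtTopIffSturdy_of_smoothCurveGenuine (hV : ∀ v, G.vertGp v = ⊤) (v₀ : G.graph.V)
    (ι : PuncturedSurfaceGroup g r →* P) (hι : IsProSigmaCompletion G.Sigma ι) (e : G.graph.C ≃ Fin r)
    (hC : ∀ c, ∃ δ : ConjAct P,
      G.cuspGp c = δ • ((cuspInertia (g := g) (e c)).map ι).topologicalClosure)
    (hgen : ∀ v, G.genus v = g) : G.SturdyAtTopIffSturdy := by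
  refine ⟨fun hst v => ?_, fun hs => ?_⟩
  · rw [hgen]
    exact G.two_le_of_isSturdyAt_top_smoothCurveGenuine hV v₀ ι hι e hC hst
  · have hg : 2 ≤ g := by rw [← hgen v₀]; exact hs v₀
    exact G.isSturdyAt_top_of_smoothCurveGenuine hV hg ι hι e hC

/-- **Def. 1.1 (ii)-sturdy at every level below the genus-`≥ 2` Galois level**: for `U ≤ V` open, `V` as
in `exists_open_normal_forall_two_le_genus_restrict`, `G_U` is a genuine smooth curve
(`restrict_smoothCurveGenuine`) of genus `≥ 2`, hence sturdy at its trivial level, i.e. `G` is sturdy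
at `U` (`isSturdyAt_restrict_top_iff`, abc-iut-w5-d226). [cite: MochizukiCombGC2007, Rmk 1.1.5 p.8] -/
theorem isSturdyAt_of_forall_two_le_genus_restrict (hV : ∀ v, G.vertGp v = ⊤) (v₀ : G.graph.V)
    (hv : ∀ w, w = v₀) (h : IsHyperbolicType g r) (ι : PuncturedSurfaceGroup g r →* P)
    (hι : IsProSigmaCompletion G.Sigma ι) (e : G.graph.C ≃ Fin r)
    (hC : ∀ c, ∃ δ : ConjAct P,
      G.cuspGp c = δ • ((cuspInertia (g := g) (e c)).map ι).topologicalClosure)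
    (hgen : ∀ v, G.genus v = g) (U : Subgroup P) [U.FiniteIndex] (hU : IsOpen (U : Set P))
    (h2 : ∀ w : (G.restrict U hU).graph.V, 2 ≤ (G.restrict U hU).genus w) : G.IsSturdyAt U := by
  obtain ⟨hN', hV', ⟨w₀, -⟩, g', r', ι', e', -, hι', -, hgen', hC'⟩ :=
    G.restrict_smoothCurveGenuine U hU hV v₀ hv h ι hι e hC hgen
  haveI := hN'
  haveI : CompactSpace U := isCompact_iff_compactSpace.mp (U.isClosed_of_isOpen hU).isCompact
  have hg' : 2 ≤ g' := by rw [← hgen' w₀]; exact h2 w₀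
  exact (G.isSturdyAt_restrict_top_iff U hU).mp
    ((G.restrict U hU).isSturdyAt_top_of_smoothCurveGenuine hV' hg' ι' hι' e' hC')

end Top

/-! ### Rmk. 1.1.5 (`SturdyCoverHolds`) at pro-`ℓ` genuine smooth-curve origins -/

section Origin

variable (Ω : PSCOrigin.{u})

/-- **[CombGC] Rmk. 1.1.5 (`SturdyCoverHolds Ω`) HOLDS at every origin of genuine smooth-curve data with
`Σ = {ℓ}`**: Def. 1.1 (ii)-sturdy at the trivial level ⟺ genus `≥ 2`; and the CHARACTERISTIC open
subgroup `H` (Mathlib's abstract `Subgroup.Characteristic`) inside the genus-`≥ 2` Galois level `V`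
(`exists_open_normal_forall_two_le_genus_restrict`), supplied by abc-iut-f-164's
`exists_characteristic_isOpen_le_of_proP` (Serre's theorem for the topologically finitely generated
pro-`ℓ` group `Π`), has every covering `G_U`, `U ≤ H` open, sturdy.  Instance form at genuine data with
cusps (e.g. the pro-`ℓ` tripod, where `H ≠ Π`). [cite: MochizukiCombGC2007, Rmk 1.1.5 p.8] -/
theorem sturdyCoverHolds_of_smoothCurveGenuine_singleton
    (hΩ : ∀ ⦃Q : Type u⦄ [Group Q] [TopologicalSpace Q] [IsTopologicalGroup Q] (G : PSCDatum Q),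
      Ω.IsOfPSCType G → CompactSpace Q ∧ T2Space Q ∧ TotallyDisconnectedSpace Q ∧ IsEmpty G.graph.N ∧
        (∀ v, G.vertGp v = ⊤) ∧ (∃ v₀ : G.graph.V, ∀ w, w = v₀) ∧ (∃ ℓ : ℕ, ℓ.Prime ∧ G.Sigma = {ℓ}) ∧
        ∃ (g r : ℕ) (ι : PuncturedSurfaceGroup g r →* Q) (e : G.graph.C ≃ Fin r),
          IsHyperbolicType g r ∧ IsProSigmaCompletion G.Sigma ι ∧ (∀ v, G.genus v = g) ∧
          ∀ c, ∃ δ : ConjAct Q, G.cuspGp c =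
            δ • ((cuspInertia (g := g) (e c)).map ι).topologicalClosure) :
    SturdyCoverHolds Ω := by
  intro Q _ _ _ G hG
  obtain ⟨hc, ht, hd, hN, hV, ⟨v₀, hv⟩, ⟨ℓ, hℓ, hSig⟩, g, r, ι, e, hgr, hι, hgen, hC⟩ := hΩ G hG
  haveI := hc; haveI := ht; haveI := hd; haveI := hN
  refine ⟨G.sturdyAtTopIffSturdy_of_smoothCurveGenuine hV v₀ ι hι e hC hgen, ?_⟩
  -- the genus-`≥ 2` Galois level `V`
  obtain ⟨V, hVo, hVn, hVgen⟩ :=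
    G.exists_open_normal_forall_two_le_genus_restrict hV v₀ hv hgr ι hι e hC hgen
  -- `Π` is a topologically finitely generated pro-`ℓ` group: a characteristic open `H ≤ V`
  haveI : Fact ℓ.Prime := ⟨hℓ⟩
  have hPℓ : ∀ U : OpenNormalSubgroup Q, IsPGroup ℓ (Q ⧸ (U : Subgroup Q)) :=
    isPGroup_quotient_of_isProSigma_singleton (hSig ▸ G.proSigma)
  have htfg : IsTopologicallyFinitelyGenerated Q :=
    IsProSigmaCompletion.isTopologicallyFinitelyGenerated_of_puncturedSurfaceGroup (MulEquiv.refl _) hι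
  obtain ⟨H, hHV, hHchar, hHo⟩ := exists_characteristic_isOpen_le_of_proP hPℓ htfg V hVo
  refine ⟨H, hHo, hHchar, fun U hUo hUH => ?_⟩
  haveI : U.FiniteIndex := IsProSigma.finiteIndex_of_isOpen G.proSigma U hUo
  exact G.isSturdyAt_of_forall_two_le_genus_restrict hV v₀ hv hgr ι hι e hC hgen U hUo
    (hVgen U hUo (hUH.trans hHV))

end Origin

end PSCDatum

end Literature.AnabelianGeometry.SemiGraphs

end
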